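import Summits.QuantumFields.BalabanUV.T4Continuum.Spine.NE3.RemainderTowerB8
import HarnessLib

/-!
# NE7QbarIterPointwiseB8Prep — preparation for the POINTWISE remainder tower on B8's surface (`NE7QbarIterPointwiseB8`): (i) lattice counting (sites of the two-`m`-block against two
# translated period boxes; bonds in a box against sites × directions; exponent bookkeeping); (ii) tower facts NOT using (1.37): periodicity of the nonlinear iterates and of the
# one-step remainder fields, and THE ℓ² SIZES OF THE NONLINEAR ITERATES `‖A_i‖_{ℓ²} ≤ 4ρ^i‖B‖_{ℓ²}` (the strong induction of `Spine/NE3/RemainderTowerB8`, exported level by level)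
Cell `pub-balaban`, rung (B)+1 sub-cell t4; row-NE7b owner lineage `b2b-balaban-t4-ne7b-p1` (gen 155), JUNCTION SERVICE for row NE7's (S-g′) (journal [NE7bP1-G155-FINDING-1], exit (a)).
WHY.  `RemainderTowerB8.sqrt_l2sq_QbarIter_le` proves `a_i := ‖Q_i(U₀, B)‖_{ℓ²(period)} ≤ 4ρ^i‖B‖_{ℓ²}` for all `i ≤ k` INSIDE its proof (inputs `RemainderTowerPrepB8.sqrt_l2sq_linCovIter_le`,
`RemainderSumsStepB8.sum_normSq_Ccov_le`, `RemainderTelescopeB8.linCovIter_sub_logCovIter_eq_sum`, `RemainderTowerArith.tower_l2_induction`); the pointwise tower needs these level sizes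
BY NAME, so this file re-runs that induction verbatim and exports it, with the periodicity bookkeeping it shares.  WHAT ([folklore]; 0 def, 0 sorry): §1 `sum_image_add_periodBox`,
`sum_boxFinset_twoBlock_le`, `sum_bondsIn_le_sum_boxFinset`, `level_weight_eq`; §2 `logCovIter_add_period_tower`, `isPeriodicCfg_cavgIter_tower`, `isPeriodicDir_Ccov_tower`,
**`sqrt_l2sq_logCovIter_le_tower`** (hypotheses = those of `RemainderTowerB8.sqrt_l2sq_QbarIter_le` minus (1.37)).  HONEST FRAMING (page 1): lattice kinematics ∕ bookkeeping over landed
kernel theorems of row NE3 and [B7] AS TYPED; nothing of Bałaban's asserted as an axiom; NE3∕NE7 NOT proved; row NE7b (`T4WeightBudget.RelWeightBound`) NOT PRINTED ∕ NOT PROVED; spine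
count = dagwriter's call; finite T⁴ rung (B)+1 — NOT infinite volume, NOT mass gap, NOT BetaPertH, NOT Clay.
-/

set_option autoImplicit false

open scoped BigOperators Matrix.Norms.L2Operator
open NormedSpace Finset

namespace Summit.QuantumFields.BalabanUV.T4Continuum.NE7QbarIterPointwiseB8Prep

open Literature.MathematicalPhysics.QuantumFieldTheory.Balaban1983to89
open B7Prop1Explicit B7Prop2Explicit B7Prop3Flat MatrixLog
open B7Prop1Local (InBox loK bondHiK)
open B7Prop3GeneralLinear (Ccov linQcov Qcov)
open B7Prop4GeneralLevels (logCovIter linCovIter)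
open B7Prop5Flat (BondIn bondsIn boxFinset mem_bondsIn mem_boxFinset)
open B7Eq123General (prop4_general level_data blockLoops_of_pdev dbavgCovIter_eq_expCfg_logCovIter)
open B7Eq92Concrete (dbavgCovIter)
open B12Ineq417Flat (shiftCfg shiftCfg_apply)
open B7AvgPeriodicity (periodic_of_coord logCovIter_periodic linCovIter_periodic Qcov_periodic)
open T4AveragingDeficitWall (IsSkewDir IsUnitaryCfg SmallField Ad dirSq)
open T4AveragingDeficitWallBoundary (IsPeriodicCfg periodBox mem_periodBox sum_periodBox_shift)
open AveragingDeficitPeriodicCounting (IsPeriodicDir)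
open AveragingDeficitChartCalculus (cavg)
open AveragingDeficitMultiLevelPrep (cavgIter LevelSmall radIter tower cavgIter_unitary_small isPeriodicCfg_cavgIter)
open AveragingDeficitMultiLevelBridge (cavgIter_eq_avgIter)
open AveragingDeficitTransport (norm_Ad_of_unitary)
open NE3TangentCovariantTower (QbarIter)
open NE3CovariantLineSumsL2 (l2sq l2sq_nonneg sqrt_l2sq_add_le)
open NE3FramePotBoundW (tower_eq_pow_mul levelSmall_of_le)
open NE3.QbarDictionary (adField)
open NE3.QbarTowerB8 (linCovIter_adField logCovIter_eq_zero_of_dbar)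
open NE3.RemainderTowerPrepB8 (shiftCfg_of_isPeriodicCfg shiftCfg_of_isPeriodicDir l2sq_adField sqrt_l2sq_neg sqrt_l2sq_finset_sum_le
  levelSmall_radIter sqrt_l2sq_linCovIter_le)
open NE3.RemainderSumsStepB8 (sum_normSq_Ccov_le sum_norm_Ccov_le)
open NE3.RemainderTelescopeB8 (linCovIter_sub_logCovIter_eq_sum linCovIter_one)
open NE3.RemainderTowerArith (tower_l2_induction geom_sum_L_le)
open ShellMeasureAverageProp4General (C1cov C1cov_pos)

noncomputable section

variable {d : ℕ} {n : Type*} [Fintype n] [DecidableEq n]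

/-! ## §1 Lattice counting: the sites of the two-`m`-block against two translated period boxes -/
omit [Fintype n] [DecidableEq n] in
/-- A sum of a non-negative function over a translate of the period box equals the period-box sum for a periodic function. [folklore] -/
theorem sum_image_add_periodBox {P : ℕ} (hP : 1 ≤ P) {g : Site d → ℝ}
    (hg : ∀ (x : Site d) (κ : Fin d), g (x + (P : ℤ) • e κ) = g x) (u : Site d) :
    ∑ x ∈ (periodBox (d := d) P).image (fun y => y + u), g x = ∑ x ∈ periodBox (d := d) P, g x := by
  rw [Finset.sum_image fun y _ y' _ h => add_right_cancel h]
  exact sum_periodBox_shift P hP hg u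
omit [Fintype n] [DecidableEq n] in
/-- **THE TWO-`m`-BLOCK IS COVERED BY TWO TRANSLATED PERIOD BOXES**: for `L^m ≤ P`, every site of `[Lᵐz, Lᵐz + (Lᵐ − 1)𝟙 + Lᵐe_κ]` lies in `Lᵐz + [0,P)^d` or in
`Lᵐz + Lᵐe_κ + [0,P)^d`; hence for a `P`-periodic `g ≥ 0` the box sum is at most twice the period-box sum. [folklore] -/
theorem sum_boxFinset_twoBlock_le {L m P : ℕ} (hLP : L ^ m ≤ P) (hP : 1 ≤ P) (z : Site d) (κ : Fin d) {g : Site d → ℝ}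
    (hg0 : ∀ x, 0 ≤ g x) (hg : ∀ (x : Site d) (κ' : Fin d), g (x + (P : ℤ) • e κ') = g x) :
    ∑ x ∈ boxFinset (loK L m z) (bondHiK L m z κ), g x ≤ 2 * ∑ x ∈ periodBox (d := d) P, g x := by
  classical
  set u₁ : Site d := loK L m z with hu₁
  set u₂ : Site d := fun i => loK L m z i + (if i = κ then ((L : ℤ) ^ m) else 0) with hu₂
  set A := (periodBox (d := d) P).image (fun y => y + u₁) with hA
  set Bx := (periodBox (d := d) P).image (fun y => y + u₂) with hB
  have hLmP : ((L : ℤ) ^ m) ≤ (P : ℤ) := by exact_mod_cast hLP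
  have hsub : boxFinset (loK L m z) (bondHiK L m z κ) ⊆ A ∪ Bx := by
    intro x hx
    rw [mem_boxFinset] at hx
    rw [Finset.mem_union]
    by_cases hcase : x κ ≤ loK L m z κ + ((L : ℤ) ^ m - 1)
    · left
      rw [hA, Finset.mem_image]
      refine ⟨x - u₁, ?_, by abel⟩
      rw [mem_periodBox]
      intro i
      have h1 := (hx i).1
      have h2 := (hx i).2
      simp only [loK, bondHiK] at h1 h2 hcase
      simp only [hu₁, loK, Pi.sub_apply]
      by_cases hi : i = κ
      · subst hi; constructor <;> omega
      · rw [if_neg hi] at h2; constructor <;> omega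
    · right
      rw [hB, Finset.mem_image]
      refine ⟨x - u₂, ?_, by abel⟩
      rw [mem_periodBox]
      intro i
      have h1 := (hx i).1
      have h2 := (hx i).2
      simp only [loK, bondHiK] at h1 h2 hcase
      simp only [hu₂, loK, Pi.sub_apply]
      by_cases hi : i = κ
      · subst hi; rw [if_pos rfl] at h2 ⊢; constructor <;> omega
      · rw [if_neg hi] at h2 ⊢; constructor <;> omega
  have hA' : ∑ x ∈ A, g x = ∑ x ∈ periodBox (d := d) P, g x := sum_image_add_periodBox hP hg u₁
  have hB' : ∑ x ∈ Bx, g x = ∑ x ∈ periodBox (d := d) P, g x := sum_image_add_periodBox hP hg u₂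
  calc ∑ x ∈ boxFinset (loK L m z) (bondHiK L m z κ), g x
      ≤ ∑ x ∈ A ∪ Bx, g x := Finset.sum_le_sum_of_subset_of_nonneg hsub fun x _ _ => hg0 x
    _ ≤ ∑ x ∈ A, g x + ∑ x ∈ Bx, g x := by
        rw [← Finset.sum_union_inter]
        have : 0 ≤ ∑ x ∈ A ∩ Bx, g x := Finset.sum_nonneg fun x _ => hg0 x
        linarith
    _ = 2 * ∑ x ∈ periodBox (d := d) P, g x := by rw [hA', hB']; ring
omit [Fintype n] [DecidableEq n] in
/-- Dropping the endpoint condition: a non-negative bond function summed over the bonds INSIDE a box is at most its sum over all bonds sourced in the box. [folklore] -/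
theorem sum_bondsIn_le_sum_boxFinset (lo hi : Site d) (h : Site d → Fin d → ℝ) (h0 : ∀ x μ, 0 ≤ h x μ) :
    ∑ b ∈ bondsIn lo hi, h b.1 b.2 ≤ ∑ x ∈ boxFinset lo hi, ∑ μ : Fin d, h x μ := by
  classical
  unfold bondsIn
  calc ∑ b ∈ ((boxFinset lo hi) ×ˢ (Finset.univ : Finset (Fin d))).filter (fun s => s.1 + e s.2 ∈ boxFinset lo hi), h b.1 b.2
      ≤ ∑ b ∈ (boxFinset lo hi) ×ˢ (Finset.univ : Finset (Fin d)), h b.1 b.2 :=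
        Finset.sum_le_sum_of_subset_of_nonneg (Finset.filter_subset _ _) fun b _ _ => h0 b.1 b.2
    _ = ∑ x ∈ boxFinset lo hi, ∑ μ : Fin d, h x μ := Finset.sum_product _ _ _

/-- the exponent bookkeeping of the pointwise tower: `Lᵐ·((Lᵐ)^d)⁻¹·(L²∕L^d)^i = L^{m+2i}·((L^{m+i})^d)⁻¹` (`L > 0`; stated with named exponents
`p = m + 2i`, `q = m + i` so that natural subtraction at the use site stays outside). [folklore] -/
theorem level_weight_eq {L : ℝ} (hL : 0 < L) (d m i : ℕ) {p q : ℕ} (hp : p = m + 2 * i) (hq : q = m + i) :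
    L ^ m * ((L ^ m) ^ d)⁻¹ * (L ^ 2 / L ^ d) ^ i = L ^ p * ((L ^ q) ^ d)⁻¹ := by
  subst hp hq
  have hL0 : L ≠ 0 := hL.ne'
  rw [div_pow, ← pow_mul, ← pow_mul, ← pow_mul, ← pow_mul]
  field_simp
  rw [← pow_add, ← pow_add, ← pow_add]
  ring

/-! ## §2 Tower facts that do not use (1.37): periodicity and the ℓ² sizes of the nonlinear iterates -/

section Tower

variable [Nonempty n] {L N : ℕ} (hL : 2 ≤ L) (hN : 1 ≤ N) (j : ℕ)
  {W : Site d → Fin d → (Matrix n n ℂ)ˣ} (hWu : IsUnitaryCfg W) (hWP : IsPeriodicCfg W ((N * L ^ (j + 1) : ℕ) : ℤ))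
  {Z : Site d → Fin d → Matrix n n ℂ} (hZP : IsPeriodicDir Z ((N * L ^ (j + 1) : ℕ) : ℤ))
omit [Fintype n] [DecidableEq n] [Nonempty n] in
/-- period bookkeeping: `L^i · (N·L^{k−i}) = N·L^k` for `i ≤ k`. [folklore] -/
theorem pow_mul_period {L N k i : ℕ} (hi : i ≤ k) : L ^ i * (N * L ^ (k - i)) = N * L ^ k := by
  rw [mul_left_comm, ← pow_add, Nat.add_sub_cancel' hi]
omit [Nonempty n] in
include hWP hZP in
/-- **PERIODICITY OF THE NONLINEAR ITERATES**: `Q_i(U₀, B)` (`B = Ad_W Z`) is `(N·L^{k−i})`-periodic for `i ≤ k = j+1` (`B7AvgPeriodicity.logCovIter_periodic`). [folklore] -/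
theorem logCovIter_add_period_tower : ∀ i ≤ j + 1, ∀ (y : Site d) (κ μ : Fin d),
    logCovIter L W (adField W Z) i (y + ((N * L ^ (j + 1 - i) : ℕ) : ℤ) • e κ) μ = logCovIter L W (adField W Z) i y μ := by
  intro i hi y κ μ
  set k : ℕ := j + 1 with hk
  have hWsh : ∀ a : Site d, shiftCfg (((N * L ^ k : ℕ) : ℤ) • a) W = W := shiftCfg_of_isPeriodicCfg hWP
  have hBP : IsPeriodicDir (adField W Z) ((N * L ^ k : ℕ) : ℤ) := by
    intro y' i' μ'; unfold adField; rw [hWP y' i' μ', hZP y' i' μ']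
  have hBsh : ∀ a : Site d, shiftCfg (((N * L ^ k : ℕ) : ℤ) • a) (adField W Z) = adField W Z := shiftCfg_of_isPeriodicDir hBP
  have hT : ∀ a : Site d, shiftCfg ((((L : ℤ) ^ i) * ((N * L ^ (k - i) : ℕ) : ℤ)) • a) W = W := by
    intro a
    have e1 : ((L : ℤ) ^ i) * ((N * L ^ (k - i) : ℕ) : ℤ) = ((N * L ^ k : ℕ) : ℤ) := by
      rw [← pow_mul_period (L := L) (N := N) hi]; push_cast; ring
    rw [e1]; exact hWsh a
  have hT' : ∀ a : Site d, shiftCfg ((((L : ℤ) ^ i) * ((N * L ^ (k - i) : ℕ) : ℤ)) • a) (adField W Z) = adField W Z := by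
    intro a
    have e1 : ((L : ℤ) ^ i) * ((N * L ^ (k - i) : ℕ) : ℤ) = ((N * L ^ k : ℕ) : ℤ) := by
      rw [← pow_mul_period (L := L) (N := N) hi]; push_cast; ring
    rw [e1]; exact hBsh a
  exact logCovIter_periodic L W (adField W Z) i hT hT' (e κ) y μ

omit [Nonempty n] in
include hWP in
/-- the averaged backgrounds `Ū₀ⁱ = cavgIter L i W` are `(N·L^{k−i})`-periodic for `i ≤ k = j+1`. [folklore] -/
theorem isPeriodicCfg_cavgIter_tower : ∀ i ≤ j + 1, IsPeriodicCfg (cavgIter L i W) ((N * L ^ (j + 1 - i) : ℕ) : ℤ) := by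
  intro i hi
  refine isPeriodicCfg_cavgIter L (N * L ^ (j + 1 - i)) i ?_
  rw [tower_eq_pow_mul, pow_mul_period hi]; exact hWP

omit [Nonempty n] in
include hWP hZP in
/-- **PERIODICITY OF THE ONE-STEP REMAINDER FIELDS**: `C_i(z, κ) = C(Ū₀ⁱ, Q_i(U₀,B), ⟨L•z, κ⟩)` is `(N·L^{k−(i+1)})`-periodic for `i < k = j+1`. [folklore] -/
theorem isPeriodicDir_Ccov_tower : ∀ i < j + 1,
    IsPeriodicDir (fun z κ => Ccov L (avgIter L W i) (logCovIter L W (adField W Z) i) ((L : ℤ) • z) κ) ((N * L ^ (j + 1 - (i + 1)) : ℕ) : ℤ) := by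
  intro i hi z κ' μ
  set k : ℕ := j + 1 with hk
  set B : Site d → Fin d → Matrix n n ℂ := adField W Z with hBdef
  have hAP := logCovIter_add_period_tower j hWP hZP
  have hVP := isPeriodicCfg_cavgIter_tower j (W := W) hWP
  have hP1 : L ^ 1 * (N * L ^ (k - (i + 1))) = N * L ^ (k - i) := by
    rw [pow_one, mul_left_comm, ← pow_succ']; congr 2; omega
  have hVsh : ∀ a : Site d, shiftCfg ((((L : ℤ) ^ 1) * ((N * L ^ (k - (i + 1)) : ℕ) : ℤ)) • a) (avgIter L W i) = avgIter L W i := by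
    intro a
    have e1 : ((L : ℤ) ^ 1) * ((N * L ^ (k - (i + 1)) : ℕ) : ℤ) = ((N * L ^ (k - i) : ℕ) : ℤ) := by
      rw [← hP1]; push_cast; ring
    rw [e1, ← cavgIter_eq_avgIter]; exact shiftCfg_of_isPeriodicCfg (hVP i hi.le) a
  have hAsh : ∀ a : Site d, shiftCfg ((((L : ℤ) ^ 1) * ((N * L ^ (k - (i + 1)) : ℕ) : ℤ)) • a) (logCovIter L W B i) = logCovIter L W B i := by
    intro a
    have e1 : ((L : ℤ) ^ 1) * ((N * L ^ (k - (i + 1)) : ℕ) : ℤ) = ((N * L ^ (k - i) : ℕ) : ℤ) := by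
      rw [← hP1]; push_cast; ring
    rw [e1]; exact shiftCfg_of_isPeriodicDir (fun y κ μ => hAP i hi.le y κ μ) a
  have hQ : Qcov L (avgIter L W i) (logCovIter L W B i) ((L : ℤ) • (z + ((N * L ^ (k - (i + 1)) : ℕ) : ℤ) • e κ')) μ
      = Qcov L (avgIter L W i) (logCovIter L W B i) ((L : ℤ) • z) μ := by
    have e1 : (L : ℤ) • (z + ((N * L ^ (k - (i + 1)) : ℕ) : ℤ) • e κ') = (L : ℤ) • z + (((N * L ^ (k - i) : ℕ) : ℤ)) • e κ' := by
      rw [smul_add, smul_smul, ← hP1]; push_cast; ring_nf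
    rw [e1]
    refine Qcov_periodic L _ _ ?_ ?_ _ μ
    · rw [← cavgIter_eq_avgIter]
      exact shiftCfg_of_isPeriodicCfg (hVP i hi.le) (e κ')
    · exact shiftCfg_of_isPeriodicDir (fun y κ μ => hAP i hi.le y κ μ) (e κ')
  have hLin : linQcov L (avgIter L W i) (logCovIter L W B i) ((L : ℤ) • (z + ((N * L ^ (k - (i + 1)) : ℕ) : ℤ) • e κ')) μ
      = linQcov L (avgIter L W i) (logCovIter L W B i) ((L : ℤ) • z) μ := by
    rw [← linCovIter_one, ← linCovIter_one]
    exact linCovIter_periodic L (avgIter L W i) (logCovIter L W B i) 1 hVsh hAsh (e κ') z μ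
  simp only [Ccov, hQ, hLin]

variable {x : ℝ} (hx : 0 ≤ x) (hsm : LevelSmall d L j x) (hWx : SmallField W x)
  {α₀ b : ℝ} (hα : 0 < α₀) (hα3 : C0 d * (2 * α₀) ≤ 1 / 3) (hα4 : 4 * (2 * α₀) ≤ c2' d L)
  (h52 : pdev W < α₀ * (((L : ℝ) ^ (j + 1))⁻¹) ^ 2) (hb : 0 ≤ b)
  (hZ : ∀ (y : Site d) (κ : Fin d), ‖Z y κ‖ ≤ b)
  (hsmall : Real.exp (4 * (800 * ((d : ℝ) + 1) ^ 2 * ((d : ℝ) + 4)) * α₀)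
    * (1 + 8 * (131072 * ((d : ℝ) + 1) ^ 2) * ((L : ℝ) ^ (j + 1) * b)) ≤ 2)
  (hc₃ : 4 * ((L : ℝ) ^ (j + 1) * b) ≤ c3 d L)
  (hK : 16 * (C1cov d * (L : ℝ) ^ 2 * Real.sqrt (d * (2 * (2 * L) + 1) ^ d)) * (L : ℝ) ^ (j + 1) * b ≤ Real.sqrt ((L : ℝ) ^ 2 / (L : ℝ) ^ d))

include hL hN hWu hWP hZP hx hsm hWx hα hα3 hα4 h52 hb hZ hsmall hc₃ hK in
set_option maxHeartbeats 800000 in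
/-- **THE ℓ² SIZES OF THE NONLINEAR ITERATES** (the strong induction of `RemainderTowerB8.sqrt_l2sq_QbarIter_le`, exported): under that theorem's hypotheses MINUS (1.37),
for every `i ≤ j+1`, `√l2sq (periodBox (N·L^{j+1−i})) (Q_i(U₀, Ad_W Z)) ≤ 4·ρ^i·√l2sq (periodBox (N·L^{j+1})) Z`, `ρ = √(L²∕L^d)`. [folklore] -/
theorem sqrt_l2sq_logCovIter_le_tower : ∀ i ≤ j + 1,
    Real.sqrt (l2sq (periodBox (d := d) (N * L ^ (j + 1 - i))) (logCovIter L W (adField W Z) i))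
      ≤ 4 * Real.sqrt ((L : ℝ) ^ 2 / (L : ℝ) ^ d) ^ i * Real.sqrt (l2sq (periodBox (d := d) (N * L ^ (j + 1))) Z) := by
  letI : CStarAlgebra (Matrix n n ℂ) := {}
  have hL1 : 1 ≤ L := by omega
  have hL0 : (0 : ℝ) < L := by exact_mod_cast (show 0 < L by omega)
  have hLR : (2 : ℝ) ≤ L := by exact_mod_cast hL
  set k : ℕ := j + 1 with hk
  set K : ℝ := C1cov d * (L : ℝ) ^ 2 * Real.sqrt (d * (2 * (2 * L) + 1) ^ d) with hKdef
  set ρ : ℝ := Real.sqrt ((L : ℝ) ^ 2 / (L : ℝ) ^ d) with hρdef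
  have hK0 : 0 ≤ K := by rw [hKdef]; have := C1cov_pos d; positivity
  have hρ0 : 0 < ρ := by rw [hρdef]; positivity
  set B : Site d → Fin d → Matrix n n ℂ := adField W Z with hBdef
  have hBsup : ∀ (y : Site d) (κ : Fin d), ‖B y κ‖ ≤ b := fun y κ => by
    rw [hBdef]; unfold adField; rw [norm_Ad_of_unitary (hWu y κ)]; exact hZ y κ
  have hG := avgClosed_unitaryUnits d (𝔸 := Matrix n n ℂ) L
  have hU₀ : ∀ (y : Site d) (κ : Fin d), W y κ ∈ unitaryUnits (Matrix n n ℂ) := hWu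
  have hα3' : C0 d * α₀ ≤ 1 / 3 := by
    have hC : 0 ≤ C0 d := by unfold C0; positivity
    nlinarith
  have hα4' : 4 * α₀ ≤ c2' d L := by linarith
  have hc₃' : 2 * ((L : ℝ) ^ k * b) ≤ c3 d L := by rw [hk]; nlinarith [pow_pos hL0 (j + 1)]
  have h4 := prop4_general L hL hG k W hU₀ hα hα3' hα4' h52 B hb hBsup hsmall hc₃'
  have hld := level_data L hL hG k W hU₀ hα hα3' hα4' h52
  have hloopsW : ∀ i < k, ∀ (z : Site d) (κ : Fin d) (r : Fin d → Fin L),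
      ‖((Wcx L (cavgIter L i W) ((L : ℤ) • z) κ (boxVec L r) : (Matrix n n ℂ)ˣ) : Matrix n n ℂ) - 1‖ < 1 := by
    intro i hi z κ r
    obtain ⟨hV, hβ0, hβ, hβmax⟩ := hld i hi.le
    rw [cavgIter_eq_avgIter]
    have h := blockLoops_of_pdev hL1 hV hβ0 hβ hβmax ((L : ℤ) • z) κ
    exact ((h.1 r).trans h.2).trans_lt (by norm_num)
  have hPk : ∀ i ≤ k, L ^ i * (N * L ^ (k - i)) = N * L ^ k := fun i hi => pow_mul_period hi
  have hBP : IsPeriodicDir B ((N * L ^ k : ℕ) : ℤ) := by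
    intro y i μ; rw [hBdef]; unfold adField; rw [hWP y i μ, hZP y i μ]
  have hAsup : ∀ i ≤ k, ∀ (y : Site d) (κ : Fin d), ‖logCovIter L W B i y κ‖ ≤ 2 * ((L : ℝ) ^ i * b) :=
    fun i hi => (h4 i hi).2
  have hAP : ∀ i ≤ k, ∀ (y : Site d) (κ μ : Fin d),
      logCovIter L W B i (y + ((N * L ^ (k - i) : ℕ) : ℤ) • e κ) μ = logCovIter L W B i y μ :=
    logCovIter_add_period_tower j hWP hZP
  have hVP : ∀ i ≤ k, IsPeriodicCfg (cavgIter L i W) ((N * L ^ (k - i) : ℕ) : ℤ) := isPeriodicCfg_cavgIter_tower j hWP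
  set Cf : ℕ → Site d → Fin d → Matrix n n ℂ :=
    fun i z κ => Ccov L (avgIter L W i) (logCovIter L W B i) ((L : ℤ) • z) κ with hCf
  set a : ℕ → ℝ := fun i => Real.sqrt (l2sq (periodBox (d := d) (N * L ^ (k - i))) (logCovIter L W B i)) with hadef
  set c : ℕ → ℝ := fun i => if i < k then Real.sqrt (l2sq (periodBox (d := d) (N * L ^ (k - (i + 1)))) (Cf i)) else 0 with hcdef
  set β : ℝ := Real.sqrt (l2sq (periodBox (d := d) (N * L ^ k)) B) with hβdef
  have hβ0 : 0 ≤ β := Real.sqrt_nonneg _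
  have hCfP : ∀ i < k, IsPeriodicDir (Cf i) ((N * L ^ (k - (i + 1)) : ℕ) : ℤ) := isPeriodicDir_Ccov_tower j hWP hZP
  -- BOUND 1: the linear propagation of `B` itself
  have hB1 : ∀ i ≤ k, Real.sqrt (l2sq (periodBox (d := d) (N * L ^ (k - i))) (linCovIter L W B i)) ≤ 2 * ρ ^ i * β := by
    intro i hi
    have hP : 1 ≤ N * L ^ (k - i) := Nat.one_le_iff_ne_zero.mpr (Nat.mul_ne_zero (by omega) (pow_ne_zero _ (by omega)))
    have hWP' : IsPeriodicCfg W ((L ^ i * (N * L ^ (k - i)) : ℕ) : ℤ) := by rw [hPk i hi]; exact hWP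
    have hBP' : IsPeriodicDir B ((L ^ i * (N * L ^ (k - i)) : ℕ) : ℤ) := by rw [hPk i hi]; exact hBP
    have h := sqrt_l2sq_linCovIter_le hL hP (j' := j) i (by omega) hWu hWP' hx hsm hWx
      (fun i'' hi'' => hloopsW i'' (by omega)) hBP'
    rw [hPk i hi] at h
    exact h
  -- BOUND 2: the linear propagation of the level-`i′` remainder from the background `Ū₀^{i′+1}`
  have hB2 : ∀ i ≤ k, ∀ i' < i, Real.sqrt (l2sq (periodBox (d := d) (N * L ^ (k - i)))
        (linCovIter L (avgIter L W (i' + 1)) (Cf i') (i - (i' + 1)))) ≤ 2 * ρ ^ (i - 1 - i') * c i' := by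
    intro i hi i' hi'
    have hik : i' < k := by omega
    have hci : c i' = Real.sqrt (l2sq (periodBox (d := d) (N * L ^ (k - (i' + 1)))) (Cf i')) := by
      simp only [hcdef, if_pos hik]
    set m : ℕ := i - (i' + 1) with hm
    have hm' : i - 1 - i' = m := by omega
    rw [hm', hci]
    have hP : 1 ≤ N * L ^ (k - i) := Nat.one_le_iff_ne_zero.mpr (Nat.mul_ne_zero (by omega) (pow_ne_zero _ (by omega)))
    have hsrc : L ^ m * (N * L ^ (k - i)) = N * L ^ (k - (i' + 1)) := by
      rw [mul_left_comm, ← pow_add]; congr 2; omega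
    rcases Nat.eq_zero_or_pos m with hm0 | hmpos
    · rw [hm0, pow_zero, mul_one]
      have e0 : k - i = k - (i' + 1) := by omega
      rw [show linCovIter L (avgIter L W (i' + 1)) (Cf i') 0 = Cf i' from rfl, e0]
      have := Real.sqrt_nonneg (l2sq (periodBox (d := d) (N * L ^ (k - (i' + 1)))) (Cf i'))
      linarith
    · have hi'j : i' + 1 ≤ j := by omega
      obtain ⟨hW'u, hr0, hW'x⟩ := cavgIter_unitary_small hL1 i' hWu hx (levelSmall_of_le (by omega) hsm) hWx
      have hsm' : LevelSmall d L (j - (i' + 1)) (radIter d L (i' + 1) x) := by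
        refine levelSmall_radIter (i' + 1) (j - (i' + 1)) ?_
        rw [Nat.add_sub_cancel' hi'j]; exact hsm
      have hW'P : IsPeriodicCfg (cavgIter L (i' + 1) W) ((L ^ m * (N * L ^ (k - i)) : ℕ) : ℤ) := by
        rw [hsrc]; exact hVP (i' + 1) hik
      have hCfP' : IsPeriodicDir (Cf i') ((L ^ m * (N * L ^ (k - i)) : ℕ) : ℤ) := by rw [hsrc]; exact hCfP i' hik
      have hloops' : ∀ i'' < m, ∀ (z : Site d) (κ : Fin d) (r : Fin d → Fin L),
          ‖((Wcx L (cavgIter L i'' (cavgIter L (i' + 1) W)) ((L : ℤ) • z) κ (boxVec L r) : (Matrix n n ℂ)ˣ) : Matrix n n ℂ) - 1‖ < 1 := by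
        intro i'' hi'' z κ r
        have e : cavgIter L i'' (cavgIter L (i' + 1) W) = cavgIter L (i' + 1 + i'') W := by
          rw [cavgIter_eq_avgIter, cavgIter_eq_avgIter, cavgIter_eq_avgIter, ← B9Eq315QTower.avgIter_add]
        rw [e]; exact hloopsW (i' + 1 + i'') (by omega) z κ r
      have h := sqrt_l2sq_linCovIter_le hL hP (j' := j - (i' + 1)) m (by omega) hW'u hW'P hr0 hsm' hW'x hloops' hCfP'
      rw [cavgIter_eq_avgIter, hsrc] at h
      exact h
  -- (hc): the one-step remainder in ℓ² (step 1) at every level `i < k`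
  have hcK : ∀ i ≤ k, c i ≤ K * (2 * (L : ℝ) ^ i * b) * a i := by
    intro i hi
    by_cases hik : i < k
    · have hci : c i = Real.sqrt (l2sq (periodBox (d := d) (N * L ^ (k - (i + 1)))) (Cf i)) := by
        simp only [hcdef, if_pos hik]
      obtain ⟨hV, hβ0', hβ', hβmax'⟩ := hld i hi
      have hN₁ : 1 ≤ N * L ^ (k - (i + 1)) := Nat.one_le_iff_ne_zero.mpr (Nat.mul_ne_zero (by omega) (pow_ne_zero _ (by omega)))
      have hLN : L * (N * L ^ (k - (i + 1))) = N * L ^ (k - i) := by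
        rw [mul_left_comm, ← pow_succ']; congr 2; omega
      have hLi : (L : ℝ) ^ i ≤ (L : ℝ) ^ k := pow_le_pow_right₀ (by linarith) hi
      have ha0 : 0 ≤ 2 * ((L : ℝ) ^ i * b) := by positivity
      have hac : 2 * ((L : ℝ) ^ i * b) ≤ c3 d L / 2 := by
        have h1 : (L : ℝ) ^ i * b ≤ (L : ℝ) ^ k * b := mul_le_mul_of_nonneg_right hLi hb
        linarith
      have hAP' : ∀ (y : Site d) (κ μ : Fin d),
          logCovIter L W B i (y + ((L * (N * L ^ (k - (i + 1))) : ℕ) : ℤ) • e κ) μ = logCovIter L W B i y μ := by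
        rw [hLN]; exact hAP i hi
      have hstep := sum_normSq_Ccov_le hL1 hV hβ0' hβ' hβmax' hN₁ (logCovIter L W B i) ha0 (hAsup i hi) hac hAP'
      rw [hLN] at hstep
      have hl : l2sq (periodBox (d := d) (N * L ^ (k - (i + 1)))) (Cf i)
          ≤ (K * (2 * ((L : ℝ) ^ i * b))) ^ 2 * l2sq (periodBox (d := d) (N * L ^ (k - i))) (logCovIter L W B i) := by
        have e : (K * (2 * ((L : ℝ) ^ i * b))) ^ 2
            = (C1cov d * (L : ℝ) ^ 2) ^ 2 * (2 * ((L : ℝ) ^ i * b)) ^ 2 * (d * (2 * (2 * (L : ℝ)) + 1) ^ d) := by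
          rw [hKdef, mul_pow, mul_pow, Real.sq_sqrt (by positivity)]; ring
        rw [e]
        exact hstep
      rw [hci, hadef]
      calc Real.sqrt (l2sq (periodBox (d := d) (N * L ^ (k - (i + 1)))) (Cf i))
          ≤ Real.sqrt ((K * (2 * ((L : ℝ) ^ i * b))) ^ 2 * l2sq (periodBox (d := d) (N * L ^ (k - i))) (logCovIter L W B i)) :=
            Real.sqrt_le_sqrt hl
        _ = K * (2 * (L : ℝ) ^ i * b) * Real.sqrt (l2sq (periodBox (d := d) (N * L ^ (k - i))) (logCovIter L W B i)) := by
            rw [Real.sqrt_mul (sq_nonneg _), Real.sqrt_sq (mul_nonneg hK0 ha0)]; ring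
    · have hci : c i = 0 := by simp only [hcdef, if_neg hik]
      rw [hci]
      have ha0' : 0 ≤ a i := by rw [hadef]; exact Real.sqrt_nonneg _
      have hL2 : 0 ≤ 2 * (L : ℝ) ^ i * b := by positivity
      exact mul_nonneg (mul_nonneg hK0 hL2) ha0'
  -- (ha): the telescoped identity at level `i`, in ℓ²
  have haK : ∀ i ≤ k, a i ≤ 2 * ρ ^ i * β + ∑ i' ∈ Finset.range i, 2 * ρ ^ (i - 1 - i') * c i' := by
    intro i hi
    have hLi : (L : ℝ) ^ i ≤ (L : ℝ) ^ k := pow_le_pow_right₀ (by linarith) hi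
    have h52i : pdev W < α₀ * (((L : ℝ) ^ i)⁻¹) ^ 2 := by
      refine h52.trans_le (mul_le_mul_of_nonneg_left ?_ hα.le)
      have h1 : ((L : ℝ) ^ k)⁻¹ ≤ ((L : ℝ) ^ i)⁻¹ := inv_anti₀ (by positivity) hLi
      exact pow_le_pow_left₀ (by positivity) h1 2
    have hid := linCovIter_sub_logCovIter_eq_sum L hL hG i W hU₀ hα hα3 hα4 h52i B
    set S : Site d → Fin d → Matrix n n ℂ := ∑ i' ∈ Finset.range i, linCovIter L (avgIter L W (i' + 1)) (Cf i') (i - (i' + 1)) with hS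
    have hAeq : logCovIter L W B i = linCovIter L W B i + S := by
      have h := hid
      rw [sub_eq_iff_eq_add] at h
      rw [h]; abel
    have h1 := sqrt_l2sq_add_le (periodBox (d := d) (N * L ^ (k - i))) (linCovIter L W B i) S
    have h2 := sqrt_l2sq_finset_sum_le (Finset.range i) (periodBox (d := d) (N * L ^ (k - i)))
      (fun i' => linCovIter L (avgIter L W (i' + 1)) (Cf i') (i - (i' + 1)))
    have h3 : ∑ i' ∈ Finset.range i, Real.sqrt (l2sq (periodBox (d := d) (N * L ^ (k - i)))
        (linCovIter L (avgIter L W (i' + 1)) (Cf i') (i - (i' + 1)))) ≤ ∑ i' ∈ Finset.range i, 2 * ρ ^ (i - 1 - i') * c i' :=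
      Finset.sum_le_sum fun i' hi' => hB2 i hi i' (Finset.mem_range.mp hi')
    rw [hadef]
    show Real.sqrt (l2sq (periodBox (d := d) (N * L ^ (k - i))) (logCovIter L W B i)) ≤ _
    rw [hAeq]
    exact h1.trans (add_le_add (hB1 i hi) (h2.trans h3))
  -- the strong ℓ² induction
  have hA4 : ∀ i ≤ k, a i ≤ 4 * ρ ^ i * β := tower_l2_induction hρ0 hLR hb hβ0 hK0 hK haK hcK
  intro i hi
  have h := hA4 i hi
  have hβZ : β = Real.sqrt (l2sq (periodBox (d := d) (N * L ^ k)) Z) := by rw [hβdef, hBdef, l2sq_adField hWu]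
  rw [hβZ] at h
  simpa only [hadef, mul_assoc] using h

end Tower

end

end Summit.QuantumFields.BalabanUV.T4Continuum.NE7QbarIterPointwiseB8Prep
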